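import Summits.QuantumFields.YangMills.Theorems.BalabanUVNodesN07DataDownTheTowerLevelBoxes
import Summits.QuantumFields.YangMills.Theorems.BalabanUVNodesN11LocalIteratedAveraging
import Summits.QuantumFields.YangMills.Theorems.BalabanUVNodesN07SplitClauseBoxesCubeDomains
import Literature.MathematicalPhysics.QuantumFieldTheory.Balaban1983to89.Node00.TorusCoverLevels
import HarnessLib

/-!
# DAG node N07 [B11] — (146) AS PRINTED: THE □̃-TOWER'S PER-LEVEL (7)-LETTERS FROM THE FINE REGULARITY OF THE REPRESENTATIVE, by [B7] Prop. 2 in its LOCAL k-fold form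
# (dag-n11-d's `plaqSmallOn_iter_avOfRecord_of_boxClosed` on the WIDENED □̃-tower family) — so FILE-1(g2)'s canonical-box `v`-clause holds with ONLY the fine regularity
# `|U′(∂p) − 1| < α₀η_k²` near `□̃`, the radial tower, the `α₀` range and the top-box geometry displayed

Cell `pub-ymgap` (HUMAN RULINGS D-0062 ∕ D-0088 ∕ D-0149), width seat `pub-ymgap-dag-n07-w6` (second wave), harness re-seat g2, 2026-08-28; CLAIM-2 ∕ INTENT-2 (cell bus).
`--kind proof --supports stmt-QuantumFields-27364 --as helper` (K1⁹ per dag-lead KEY MAP v2; count-neutral).  THEOREMS ONLY.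

THE PRINT.  [B11] = [Balaban1985Variational] p. 301 (146): «the regularity of `U′` on `□̃` … `|∂(U′)^j − 1| < O(1)L^{2j}η²ε₀` on the blocks of `□̃`» (the averages of a regular field are
regular, level by level); [B7] = [Balaban1985Averaging] Prop. 1 (51) pp. 25–26, Prop. 2 (52)–(53) p. 26 «the bound above depends on bounds for `V(∂p) − 1` on `Δ(p′)`» — typed LOCALLY
and k-fold by dag-n11-d (`…N11LocalIteratedAveraging.plaqSmallOn_iter_avOfRecord_of_boxClosed`: a family of plaquette sets `S i ⊆ T^{(i)}` that is BOX-CLOSED DOWNWARD inherits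
`|Ū^j(∂p′) − 1| < 2α₀(L^jη_k)²` on `S j` from `|U(∂p) − 1| < α₀η_k²` on `S 0`); [6] = [Balaban1985RegularSpaces] p. 98 (the cube `□̃`).

WHAT THIS FILE DOES (torus ∕ box bookkeeping + by-name composition; NOTHING of [B11]∕[B7]∕[6] analysis asserted beyond dag-n11-d's landed port).
* §1 torus bookkeeping on the covers (`Node00.TorusCoverLevels`): `exists_castSite_of_blockOf_eq` (a site whose block is labelled `z′` carries a label `w` with `L·z′ ≤ w ≤ L·z′ + (L−1)`),
  `exists_castSite_of_mem_boxRegion` (dag-n20-d's `boxRegion` around a labelled site, read in labels), `margin_wide_succ` (`(L+R)·gs L (n+1) = L·((L+R)·gs L n) + (L + R)`).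
* §2 THE WIDENED □̃-TOWER FAMILY `i ↦ {q : Plaq i | q.src = castSite x, x ∈ [tlo L (tLo a ρ)(k−i) − m_{k−i}, thi L (tHi a M ρ)(k−i) + m_{k−i}]}`, margins `m_n := (L+R)·gs L n`, `R := (d+4)L + 2`
  (stated INLINE — no `def`): ★ `boxClosed_tildeTowerWide` (dag-n11-d's box-closure hypothesis `hS`), `mem_tildeTowerWide_of_blockOf_mem` (every level-`j` plaquette whose block label is within
  `1` of the level-`(j+1)` □̃-box — the plaquettes FILE-1(g2) §2's `hplaq`∕`hplaqB` quantify over — lies in the family), `boxPlaqs_tilde_subset_tildeTowerWide` (the top box's plaquettes).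
* §3 ★★ `plaqSmallOn_tildeTowerWide_of_fine` ([B7] Prop. 2 LOCAL on the family: all levels `j ≤ k`, and the top level at threshold `2α₀`), `smallness_ht_of_alpha` (`((d+2)L)²∕4 · 2α₀(Lʲη_k)² < δ_N` from
  `2α₀ ≤ 2δ_N∕((d+4)L)²`), ★★★ `dist1_iter_le_down_the_radialRep_levelBoxes_of_fine` = FILE-1(g2) §3's ★★★ `dist1_iter_le_down_the_radialRep_levelBoxes_explicit` with `hplaq`∕`hplaqB`∕`hV`∕`ht`
  DISCHARGED (`a_i := 2α₀(Lⁱη_k)²`, top letter `2α₀`): the S6 head's canonical-box `v`-clause with ONLY the fine regularity of `U′` on the widened fine □̃, the radial tower of `U′`, the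
  `α₀` range, `1 ≤ M`, `1 ≤ ρ`, `M + 4ρ < sitesPerDir k` displayed, and the EXPLICIT ladder `v_j = (d−1)(M+4ρ−1)·2α₀ + C′·Σ_{i∈[j,k)} 2α₀(Lⁱη_k)²` — AFFINE in `α₀`.

HONEST FRAMING (binding).  Count-neutral helper; by-name composition of LANDED theorems (dag-n11-d's local [B7] Prop. 2 port, FILE-1(g2), FILE 6 `dist1_plaqHol_iter_gaugeAct`, dag-n07-w4
p627154's `castSite_sub_e`, `Node00.TorusCoverLevels`) with elementary label arithmetic; the fine regularity of the representative near `□̃` (print: from (144)∕(17) once `□̃ ⊂ 𝔅_{j−1}`,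
p. 300 — THAT placement and the letter `α₀ := O(L²)ε_{j−1}` are the consumer's), its radial tower, the `α₀` range and non-wrapping are HYPOTHESES; nothing of [B11]∕[B7]∕[6] analysis
asserted here; `HCHART` NOT discharged; `stub_prop8StepCoP13` ∕ K0⁷ ∕ K1⁹ NOT closed; N07 NOT discharged; the chair's tally of record is the only count; **no summit statement is proved by
this seat** — one finite `T⁴` programme at fixed `ε`, Bałaban AS PRINTED; the route closes the conditional finite-𝕋⁴ rung `BalabanLadder.UV` only; NOT continuum ∕ ℝ⁴ ∕ OS ∕ mass gap ∕
Clay.  No `sorry`, no `def`, no `instance`, no `notation`.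

RELATED IN THE TREE, NOT DUPLICATED: dag-n11-d `…N11LocalIteratedAveraging` (CONSUMED), dag-n21-c `…N21AveragedDatumRegularity.plaqSmall_iter_avOfRecord(_level)` (the GLOBAL form — not
usable here: the representative is regular near `□̃` only), FILE-1(g2) `…N07DataDownTheTowerLevelBoxes` (CONSUMED), FILE 6 ∕ FILE 9 (upstream).
-/

noncomputable section

namespace Summit.QuantumFields.YangMills.BalabanUVNodes.N07TildeTowerLettersFromFine

open scoped Matrix.Norms.L2Operator BigOperators
open Literature.MathematicalPhysics.QuantumFieldTheory.Balaban1983to89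
open Literature.MathematicalPhysics.QuantumFieldTheory.Balaban1983to89.Node00
open Literature.MathematicalPhysics.QuantumLattice (blockMap)
open T4Continuum
open T4AxialGaugeSmallField (castSite castSite_apply axialGauge boxPlaqs)
open B15Eq177GaugeInvariance (blockLift)
open GaugeField (gaugeAct)
open ExpMeanLog (deltaSU deltaSU_pos)
open B7Prop1Explicit (e e_apply)
open B8Eq131Cubes (gs gs_succ one_le_gs sqLo sqHi tLo tHi)
open B8Ineq130 (tlo thi)
open Summit.QuantumFields.Balaban3D.Carriers (radialContourData)
open Summit.QuantumFields.YangMills.BalabanUVNodes.N20LCSAvgDominationRegion (boxRegion mem_boxRegion)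
open Summit.QuantumFields.YangMills.Theorems.BalabanUVNodesN11LocalIteratedAveraging (plaqSmallOn_iter_avOfRecord_of_boxClosed plaqSmallOn_iter_avOfRecord_of_boxClosed_top)
open Summit.QuantumFields.YangMills.BalabanUVNodes.N07SplitClauseBoxesCubeDomains (castSite_sub_e tgt_eq_castSite_add_e)
open Summit.QuantumFields.YangMills.BalabanUVNodes.N07DataDownTheTowerBlowDown (dist1_plaqHol_iter_gaugeAct)
open Summit.QuantumFields.YangMills.BalabanUVNodes.N07DataDownTheTowerLevelBoxes (tildeTower_lo_step tildeTower_hi_step dist1_iter_le_down_the_radialRep_levelBoxes_explicit)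

/-! ## §1  Torus bookkeeping on the covers -/

section Torus

variable {P : Params}

/-- The projection of FILE 1's vocabulary IS the level cover of `Node00.TorusCoverLevels` (definitional). [cite: Balaban1987RG1, (0.1) p.251] -/
theorem coverAt_eq_castSite (j : ℕ) (x : Fin P.d → ℤ) : coverAt P j x = (castSite x : Site P j) := rfl

/-- **A SITE WHOSE BLOCK IS LABELLED `z′` CARRIES A LABEL IN THE BLOW-UP OF `z′`**: `blockOf x = π_{i+1} z′` (`i + 1 ≤ m + K`) gives `x = π_i w` with `L·z′ ≤ w ≤ L·z′ + (L − 1)`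
coordinatewise (`blockOf_coverAt` + a deck translation). [cite: Balaban1987RG1, (0.1)–(0.3) pp.251–252] -/
theorem exists_castSite_of_blockOf_eq {i : ℕ} (hi : i + 1 ≤ P.m + P.K) {x : Site P i} {z' : Fin P.d → ℤ} (h : blockOf x = (castSite z' : Site P (i + 1))) :
    ∃ w : Fin P.d → ℤ, (∀ κ, (P.L : ℤ) * z' κ ≤ w κ ∧ w κ ≤ (P.L : ℤ) * z' κ + ((P.L : ℤ) - 1)) ∧ x = castSite w := by
  obtain ⟨x₀, rfl⟩ := coverAt_surjective i x
  rw [blockOf_coverAt hi, ← coverAt_eq_castSite, coverAt_eq_coverAt_iff] at h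
  choose v hv using h
  have hL : (0 : ℤ) < (P.L : ℤ) := by exact_mod_cast P.L_pos
  have hN : ((P.sitesPerDir i : ℕ) : ℤ) = ((P.sitesPerDir (i + 1) : ℕ) : ℤ) * (P.L : ℤ) := by
    rw [P.sitesPerDir_eq_mul_succ hi]; push_cast; ring
  refine ⟨x₀ + fun μ => ((P.sitesPerDir i : ℕ) : ℤ) * v μ, fun κ => ?_, ?_⟩
  · have hq : (x₀ κ + ((P.sitesPerDir i : ℕ) : ℤ) * v κ) / (P.L : ℤ) = z' κ := by
      rw [hN, show x₀ κ + ((P.sitesPerDir (i + 1) : ℕ) : ℤ) * (P.L : ℤ) * v κ = x₀ κ + (P.L : ℤ) * (((P.sitesPerDir (i + 1) : ℕ) : ℤ) * v κ) by ring,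
        Int.add_mul_ediv_left _ _ hL.ne']
      have := hv κ
      simp only [blockMap] at this
      linarith
    set w := x₀ κ + ((P.sitesPerDir i : ℕ) : ℤ) * v κ with hw
    have h1 := Int.mul_ediv_add_emod w (P.L : ℤ)
    have h2 := Int.emod_nonneg w hL.ne'
    have h3 := Int.emod_lt_of_pos w hL
    rw [hq] at h1
    simp only [Pi.add_apply]
    constructor <;> linarith
  · rw [← coverAt_eq_castSite, coverAt_add_period]

/-- **dag-n20-d's BOX REGION READ IN LABELS**: a plaquette in `boxRegion (π_i w) R` is based at `π_i (w + e)` with `|e_ν| ≤ R`. [cite: Balaban1985Averaging, Prop. 1 (51) p.25 («on Δ(p′)»)] -/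
theorem exists_castSite_of_mem_boxRegion {i : ℕ} {w : Fin P.d → ℤ} {R : ℕ} {q : Plaq P i} (h : q ∈ boxRegion (castSite w : Site P i) R) :
    ∃ e' : Fin P.d → ℤ, (∀ ν, |e' ν| ≤ (R : ℤ)) ∧ q.src = castSite (w + e') := by
  rw [mem_boxRegion] at h
  choose e' he using h
  refine ⟨e', fun ν => (he ν).1, funext fun ν => ?_⟩
  rw [(he ν).2, castSite_apply, castSite_apply, Pi.add_apply, Int.cast_add]

/-- The widened margins recurse like a blow-down tower with slack `L + R`: `(L+R)·gs L (n+1) = L·((L+R)·gs L n) + (L + R)`. [folklore] -/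
theorem margin_wide_succ (L R n : ℕ) : (L + R) * gs L (n + 1) = L * ((L + R) * gs L n) + (L + R) := by
  rw [gs_succ]; ring

/-- The widened margins dominate `L`: `L ≤ (L+R)·gs L n`. [folklore] -/
theorem le_margin_wide (L R n : ℕ) : L ≤ (L + R) * gs L n := by
  have := one_le_gs L n
  nlinarith

end Torus

/-! ## §2  The widened □̃-tower family is box-closed downward and contains the plaquettes FILE-1(g2) §2 reads -/

section Family

variable {P : Params}

/-- ★ **THE WIDENED □̃-TOWER FAMILY IS BOX-CLOSED DOWNWARD** (dag-n11-d's hypothesis `hS`): a level-`(i+1)` plaquette based at a label within `m_{k−i−1}` of `□̃^{(i+1)}` has its whole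
level-`i` box region `boxRegion (emb p.src) R` based at labels within `m_{k−i} = L·m_{k−i−1} + L + R` of `□̃^{(i)}` (`emb_coverAt`: the centre label `L·z + (L−1)∕2`).
[cite: Balaban1985Averaging, Prop. 1 (51) pp.25–26 («Δ(p′)»); Balaban1987RG1, (0.1) p.251; Balaban1985RegularSpaces, p.98] -/
theorem boxClosed_tildeTowerWide (a : Fin P.d → ℤ) (M ρ R : ℕ) {k : ℕ} (hk : k ≤ P.m + P.K) :
    ∀ i, i < k → ∀ p ∈ {q : Plaq P (i + 1) | ∃ x : Fin P.d → ℤ, (∀ κ, tlo P.L (tLo a ρ) (k - (i + 1)) κ - (((P.L + R) * gs P.L (k - (i + 1)) : ℕ) : ℤ) ≤ x κ ∧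
        x κ ≤ thi P.L (tHi a M ρ) (k - (i + 1)) κ + (((P.L + R) * gs P.L (k - (i + 1)) : ℕ) : ℤ)) ∧ q.src = castSite x},
      (↑(boxRegion (emb p.src) R) : Set (Plaq P i)) ⊆
        {q : Plaq P i | ∃ x : Fin P.d → ℤ, (∀ κ, tlo P.L (tLo a ρ) (k - i) κ - (((P.L + R) * gs P.L (k - i) : ℕ) : ℤ) ≤ x κ ∧
          x κ ≤ thi P.L (tHi a M ρ) (k - i) κ + (((P.L + R) * gs P.L (k - i) : ℕ) : ℤ)) ∧ q.src = castSite x} := by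
  intro i hi p hp q hq
  obtain ⟨z, hz, hsrc⟩ := hp
  have hi' : i + 1 ≤ P.m + P.K := by omega
  have hemb : emb p.src = (castSite (fun μ => (P.L : ℤ) * z μ + ((P.L - 1) / 2 : ℕ)) : Site P i) := by
    rw [hsrc, ← coverAt_eq_castSite, emb_coverAt hi', coverAt_eq_castSite]
  rw [Finset.mem_coe, hemb] at hq
  obtain ⟨e', he', hq⟩ := exists_castSite_of_mem_boxRegion hq
  refine ⟨_, fun κ => ?_, hq⟩
  have hn : k - i = (k - (i + 1)) + 1 := by omega
  have hlo := congrFun (tildeTower_lo_step P.L a ρ hi) κ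
  have hhi := congrFun (tildeTower_hi_step P.L a M ρ hi) κ
  have hm : (((P.L + R) * gs P.L (k - i) : ℕ) : ℤ) = (P.L : ℤ) * (((P.L + R) * gs P.L (k - (i + 1)) : ℕ) : ℤ) + ((P.L : ℤ) + R) := by
    rw [hn, margin_wide_succ]; push_cast; ring
  have hhalf : (((P.L - 1) / 2 : ℕ) : ℤ) ≤ (P.L : ℤ) - 1 := by
    have h1 : (P.L - 1) / 2 ≤ P.L - 1 := Nat.div_le_self _ _
    have h2 : ((P.L - 1 : ℕ) : ℤ) = (P.L : ℤ) - 1 := by rw [Nat.cast_sub P.L_pos]; simp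
    have h3 : (((P.L - 1) / 2 : ℕ) : ℤ) ≤ ((P.L - 1 : ℕ) : ℤ) := by exact_mod_cast h1
    linarith
  have hhalf0 : (0 : ℤ) ≤ (((P.L - 1) / 2 : ℕ) : ℤ) := by positivity
  have he1 := (abs_le.mp (he' κ)).1
  have he2 := (abs_le.mp (he' κ)).2
  obtain ⟨hz1, hz2⟩ := hz κ
  have hL0 : (0 : ℤ) ≤ (P.L : ℤ) := by positivity
  have hm0 : (0 : ℤ) ≤ (((P.L + R) * gs P.L (k - (i + 1)) : ℕ) : ℤ) := by positivity
  rw [hlo, hhi, hm]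
  simp only [Pi.add_apply]
  constructor <;> nlinarith

/-- **THE PLAQUETTES FILE-1(g2) §2 READS LIE IN THE FAMILY**: a level-`j` plaquette (`j < k ≤ m + K`) whose block label is within `1` of the □̃-box `□̃^{(j+1)}` is based at a label within
`L ≤ m_{k−j}` of `□̃^{(j)}`. [cite: Balaban1985Variational, (145)–(146) p.301; Balaban1987RG1, (0.1)–(0.3) pp.251–252] -/
theorem mem_tildeTowerWide_of_blockOf_mem (a : Fin P.d → ℤ) (M ρ R : ℕ) {k : ℕ} (hk : k ≤ P.m + P.K) {j : ℕ} (hj : j < k) (q : Plaq P j) {z' : Fin P.d → ℤ}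
    (hz' : ∀ κ, tlo P.L (tLo a ρ) (k - (j + 1)) κ - 1 ≤ z' κ ∧ z' κ ≤ thi P.L (tHi a M ρ) (k - (j + 1)) κ + 1) (hq : blockOf q.src = (castSite z' : Site P (j + 1))) :
    q ∈ {q : Plaq P j | ∃ x : Fin P.d → ℤ, (∀ κ, tlo P.L (tLo a ρ) (k - j) κ - (((P.L + R) * gs P.L (k - j) : ℕ) : ℤ) ≤ x κ ∧
      x κ ≤ thi P.L (tHi a M ρ) (k - j) κ + (((P.L + R) * gs P.L (k - j) : ℕ) : ℤ)) ∧ q.src = castSite x} := by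
  obtain ⟨w, hw, hsrc⟩ := exists_castSite_of_blockOf_eq (by omega) hq
  refine ⟨w, fun κ => ?_, hsrc⟩
  have hlo := congrFun (tildeTower_lo_step P.L a ρ hj) κ
  have hhi := congrFun (tildeTower_hi_step P.L a M ρ hj) κ
  have hm : (P.L : ℤ) ≤ (((P.L + R) * gs P.L (k - j) : ℕ) : ℤ) := by exact_mod_cast le_margin_wide P.L R (k - j)
  obtain ⟨hw1, hw2⟩ := hw κ
  obtain ⟨hz1, hz2⟩ := hz' κ
  have hL0 : (0 : ℤ) ≤ (P.L : ℤ) := by positivity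
  rw [hlo, hhi]
  constructor <;> nlinarith

/-- The three block positions of FILE-1(g2) §2's `hplaq` (`c.src − e_dir`, `c.src`, `c.tgt` for a bond `c` of the □̃-box `□̃^{(j+1)}`) and the one of `hplaqB` (`y ∈ □̃^{(j+1)}`) are labels
within `1` of `□̃^{(j+1)}`. [cite: Balaban1985Variational, (145) p.301; Balaban1985RegularSpaces, Lemma 1 (1.25) p.79 (the three plaquette positions)] -/
theorem exists_label_near_of_block_position {j : ℕ} {lo hi : Fin P.d → ℤ} (c : PBond P (j + 1))
    (hs : c.src ∈ (castSite '' Set.Icc lo hi : Set (Site P (j + 1)))) (ht : c.tgt ∈ (castSite '' Set.Icc lo hi : Set (Site P (j + 1)))) (y : Site P (j + 1))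
    (hy : y = c.src.unshift c.dir ∨ y = c.src ∨ y = c.tgt) :
    ∃ z' : Fin P.d → ℤ, (∀ κ, lo κ - 1 ≤ z' κ ∧ z' κ ≤ hi κ + 1) ∧ y = castSite z' := by
  obtain ⟨s, hsI, hsrc⟩ := hs
  obtain ⟨t, htI, htgt⟩ := ht
  rw [Set.mem_Icc] at hsI htI
  rcases hy with h | h | h
  · refine ⟨s - e c.dir, fun κ => ?_, by rw [h, ← hsrc, castSite_sub_e]⟩
    have h1 := hsI.1 κ; have h2 := hsI.2 κ
    simp only [Pi.sub_apply, e_apply]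
    split_ifs <;> constructor <;> linarith
  · exact ⟨s, fun κ => ⟨by linarith [hsI.1 κ], by linarith [hsI.2 κ]⟩, by rw [h, hsrc]⟩
  · exact ⟨t, fun κ => ⟨by linarith [htI.1 κ], by linarith [htI.2 κ]⟩, by rw [h, htgt]⟩

/-- **THE TOP BOX'S PLAQUETTES LIE IN THE FAMILY**: `boxPlaqs (tLo a ρ) (tHi a M ρ) ⊆` the level-`k` member (margin `m₀ = L + R ≥ 0`). [cite: Balaban1985RegularSpaces, p.98 («□̃»)] -/
theorem boxPlaqs_tilde_subset_tildeTowerWide (a : Fin P.d → ℤ) (M ρ R k : ℕ) :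
    (boxPlaqs (tLo a ρ) (tHi a M ρ) : Set (Plaq P k)) ⊆
      {q : Plaq P k | ∃ x : Fin P.d → ℤ, (∀ κ, tlo P.L (tLo a ρ) (k - k) κ - (((P.L + R) * gs P.L (k - k) : ℕ) : ℤ) ≤ x κ ∧
        x κ ≤ thi P.L (tHi a M ρ) (k - k) κ + (((P.L + R) * gs P.L (k - k) : ℕ) : ℤ)) ∧ q.src = castSite x} := by
  rintro p ⟨z, hlo, hhi, hsrc⟩
  refine ⟨z, fun κ => ?_, hsrc⟩
  simp only [Nat.sub_self, B8Ineq130.tlo_zero, B8Ineq130.thi_zero]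
  have h1 := hlo κ
  have h2 := hhi κ
  simp only [Pi.add_apply, e_apply] at h2
  have hm0 : (0 : ℤ) ≤ (((P.L + R) * gs P.L 0 : ℕ) : ℤ) := by positivity
  constructor
  · linarith
  · split_ifs at h2 <;> linarith

end Family

/-! ## §3  [B7] Prop. 2 LOCAL on the family, and the capstone with only fine regularity displayed -/

section Fine

variable {F : T4Continuum.T4Family} {N : ℕ} [NeZero N] {K : ℕ}

/-- ★★ **[B7] PROP. 2, LOCAL AND k-FOLD, ON THE WIDENED □̃-TOWER** (dag-n11-d's `plaqSmallOn_iter_avOfRecord_of_boxClosed` BY NAME, `R := (d+4)L + 2`): `|U′(∂p) − 1| < α₀η_k²` on the level-0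
member gives, for every `j ≤ k`, `|∂(M^j U′) − 1| < 2α₀(Lʲη_k)²` on the level-`j` member; and `< 2α₀` on the top member. [cite: Balaban1985Averaging, Prop. 2 (52)–(53) p.26; Balaban1985Variational, (146) p.301] -/
theorem plaqSmallOn_tildeTowerWide_of_fine {k : ℕ} (hk : k ≤ (F.P K).m + (F.P K).K) (a₀ : Fin (F.P K).d → ℤ) (M ρ : ℕ)
    {α₀ : ℝ} (hα : 0 < α₀) (hα3 : (143 * (((((F.P K).d + 4 : ℕ) : ℝ)) ^ 2 / 4) ^ 2) * α₀ ≤ 1 / 3)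
    (hα2 : 2 * α₀ ≤ 2 * deltaSU (Fin N) / ((((F.P K).d + 4) * (F.P K).L : ℕ) : ℝ) ^ 2) {U' : GaugeField (F.P K) 0 (SU N)}
    (h52 : PlaqSmallOn {q : Plaq (F.P K) 0 | ∃ x : Fin (F.P K).d → ℤ,
        (∀ κ, tlo (F.P K).L (tLo a₀ ρ) k κ - ((((F.P K).L + (((F.P K).d + 4) * (F.P K).L + 2)) * gs (F.P K).L k : ℕ) : ℤ) ≤ x κ ∧
          x κ ≤ thi (F.P K).L (tHi a₀ M ρ) k κ + ((((F.P K).L + (((F.P K).d + 4) * (F.P K).L + 2)) * gs (F.P K).L k : ℕ) : ℤ)) ∧ q.src = castSite x}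
      (α₀ * (F.P K).eta k ^ 2) U') :
    (∀ j ≤ k, PlaqSmallOn {q : Plaq (F.P K) j | ∃ x : Fin (F.P K).d → ℤ,
        (∀ κ, tlo (F.P K).L (tLo a₀ ρ) (k - j) κ - ((((F.P K).L + (((F.P K).d + 4) * (F.P K).L + 2)) * gs (F.P K).L (k - j) : ℕ) : ℤ) ≤ x κ ∧
          x κ ≤ thi (F.P K).L (tHi a₀ M ρ) (k - j) κ + ((((F.P K).L + (((F.P K).d + 4) * (F.P K).L + 2)) * gs (F.P K).L (k - j) : ℕ) : ℤ)) ∧ q.src = castSite x}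
      (2 * α₀ * ((((F.P K).L : ℝ) ^ j * (F.P K).eta k) ^ 2)) (Averaging.iter (avOfRecord F N K) j U')) ∧
    PlaqSmallOn {q : Plaq (F.P K) k | ∃ x : Fin (F.P K).d → ℤ,
        (∀ κ, tlo (F.P K).L (tLo a₀ ρ) (k - k) κ - ((((F.P K).L + (((F.P K).d + 4) * (F.P K).L + 2)) * gs (F.P K).L (k - k) : ℕ) : ℤ) ≤ x κ ∧
          x κ ≤ thi (F.P K).L (tHi a₀ M ρ) (k - k) κ + ((((F.P K).L + (((F.P K).d + 4) * (F.P K).L + 2)) * gs (F.P K).L (k - k) : ℕ) : ℤ)) ∧ q.src = castSite x}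
      (2 * α₀) (Averaging.iter (avOfRecord F N K) k U') := by
  set T : (i : ℕ) → Set (Plaq (F.P K) i) := fun i => {q : Plaq (F.P K) i | ∃ x : Fin (F.P K).d → ℤ,
        (∀ κ, tlo (F.P K).L (tLo a₀ ρ) (k - i) κ - ((((F.P K).L + (((F.P K).d + 4) * (F.P K).L + 2)) * gs (F.P K).L (k - i) : ℕ) : ℤ) ≤ x κ ∧
          x κ ≤ thi (F.P K).L (tHi a₀ M ρ) (k - i) κ + ((((F.P K).L + (((F.P K).d + 4) * (F.P K).L + 2)) * gs (F.P K).L (k - i) : ℕ) : ℤ)) ∧ q.src = castSite x} with hT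
  have hS : ∀ i, i < k → ∀ p ∈ T (i + 1), (↑(boxRegion (emb p.src) (((F.P K).d + 4) * (F.P K).L + 2)) : Set (Plaq (F.P K) i)) ⊆ T i :=
    boxClosed_tildeTowerWide (P := F.P K) a₀ M ρ (((F.P K).d + 4) * (F.P K).L + 2) hk
  have h52' : PlaqSmallOn (T 0) (α₀ * (F.P K).eta k ^ 2) U' := by
    rw [hT]
    simpa only [Nat.sub_zero] using h52
  exact ⟨fun j hj => plaqSmallOn_iter_avOfRecord_of_boxClosed F N K k T hS hα hα3 hα2 h52' hj,
    plaqSmallOn_iter_avOfRecord_of_boxClosed_top F N K k T hS hα hα3 hα2 h52'⟩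

/-- The smallness letter of the tower: `((d+2)L)²∕4 · 2α₀(Lʲη_k)² < δ_N` for `j ≤ k`, from `2α₀ ≤ 2δ_N∕((d+4)L)²` (`(d+2)² < 2(d+4)²`). [cite: Balaban1985RegularSpaces, Lemma 1 (1.25) p.79 (the threshold); Balaban1985Averaging, (54) p.26] -/
theorem smallness_ht_of_alpha (P : Params) {α₀ δN : ℝ} (hδ : 0 < δN) (hα2 : 2 * α₀ ≤ 2 * δN / (((P.d + 4) * P.L : ℕ) : ℝ) ^ 2) {k j : ℕ} (hj : j ≤ k) :
    ((((P.d + 2) * P.L : ℕ) : ℝ) ^ 2 / 4) * (2 * α₀ * (((P.L : ℝ) ^ j * P.eta k) ^ 2)) < δN := by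
  have hL1 : (1 : ℝ) ≤ P.L := by exact_mod_cast P.L_pos
  have hLpos : (0 : ℝ) < ((P.L : ℝ)) ^ k := by positivity
  have hx1 : ((P.L : ℝ) ^ j * P.eta k) ^ 2 ≤ 1 := by
    rw [Params.eta, inv_pow]
    have hjk : (P.L : ℝ) ^ j * ((P.L : ℝ) ^ k)⁻¹ ≤ 1 := by
      rw [mul_inv_le_iff₀ hLpos, one_mul]
      exact pow_le_pow_right₀ hL1 hj
    have h0 : 0 ≤ (P.L : ℝ) ^ j * ((P.L : ℝ) ^ k)⁻¹ := by positivity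
    nlinarith
  have hQ4 : (0 : ℝ) < (((P.d + 4) * P.L : ℕ) : ℝ) ^ 2 := by
    have : (0 : ℝ) < (((P.d + 4) * P.L : ℕ) : ℝ) := by have := P.L_pos; positivity
    positivity
  have hα0 : 2 * α₀ ≤ 2 * δN / (((P.d + 4) * P.L : ℕ) : ℝ) ^ 2 := hα2
  have hAB : (((P.d + 2) * P.L : ℕ) : ℝ) ^ 2 ≤ (((P.d + 4) * P.L : ℕ) : ℝ) ^ 2 := by
    have h : (((P.d + 2) * P.L : ℕ) : ℝ) ≤ (((P.d + 4) * P.L : ℕ) : ℝ) := by exact_mod_cast Nat.mul_le_mul_right _ (by omega)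
    exact pow_le_pow_left₀ (by positivity) h 2
  have hratio : 2 * ((((P.d + 2) * P.L : ℕ) : ℝ) ^ 2 / 4) < (((P.d + 4) * P.L : ℕ) : ℝ) ^ 2 := by linarith
  have hQ2 : (0 : ℝ) ≤ (((P.d + 2) * P.L : ℕ) : ℝ) ^ 2 / 4 := by positivity
  rcases le_or_gt α₀ 0 with hαn | hαn
  · have : ((((P.d + 2) * P.L : ℕ) : ℝ) ^ 2 / 4) * (2 * α₀ * (((P.L : ℝ) ^ j * P.eta k) ^ 2)) ≤ 0 :=
      mul_nonpos_of_nonneg_of_nonpos hQ2 (mul_nonpos_of_nonpos_of_nonneg (by linarith) (by positivity))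
    linarith
  · calc ((((P.d + 2) * P.L : ℕ) : ℝ) ^ 2 / 4) * (2 * α₀ * (((P.L : ℝ) ^ j * P.eta k) ^ 2))
        ≤ ((((P.d + 2) * P.L : ℕ) : ℝ) ^ 2 / 4) * (2 * α₀) := by
          refine mul_le_mul_of_nonneg_left ?_ hQ2
          nlinarith
      _ ≤ ((((P.d + 2) * P.L : ℕ) : ℝ) ^ 2 / 4) * (2 * δN / (((P.d + 4) * P.L : ℕ) : ℝ) ^ 2) := mul_le_mul_of_nonneg_left hα0 hQ2
      _ = (2 * ((((P.d + 2) * P.L : ℕ) : ℝ) ^ 2 / 4) / (((P.d + 4) * P.L : ℕ) : ℝ) ^ 2) * δN := by ring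
      _ < 1 * δN := by
          refine mul_lt_mul_of_pos_right ?_ hδ
          rwa [div_lt_one hQ4]
      _ = δN := one_mul _

/-- ★★★ **THE S6 HEAD's CANONICAL-BOX `v`-CLAUSE WITH ONLY FINE REGULARITY DISPLAYED** ([B11] (145)–(147), (151) with (146) SUPPLIED by [B7] Prop. 2 local): `U′` carries the radial tower below
`k` (`1 ≤ k ≤ m + K`); its FINE plaquettes based at labels within `m₀ = (L+R)·gs L k` of the fine □̃ `[tlo L (tLo a ρ) k, thi L (tHi a M ρ) k]` are `< α₀η_k²`, `α₀` in dag-n11-d's range; `1 ≤ M`,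
`1 ≤ ρ`, non-wrapping `M + 4ρ < sitesPerDir k`.  Then at the (147) representative `U″ := U′^{h̄}`, `h := axialGauge (M^k U′) (tLo a ρ) (tHi a M ρ)`, every level-`j` bond `c` of p627154's canonical
box (four equations) obeys `dist1 (M^j U″ c) ≤ (d−1)(M+4ρ−1)·2α₀ + C′·Σ_{i∈[j,k)} 2α₀(Lⁱη_k)²` — AFFINE in `α₀`, uniform in the datum.
[cite: Balaban1985Variational, (144) p.300, (145)–(147) p.301, (151) p.301; Balaban1985Averaging, Prop. 2 (52)–(53) p.26; Balaban1985RegularSpaces, p.98, (1.15) p.78, Lemma 1 (1.25) p.79] -/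
theorem dist1_iter_le_down_the_radialRep_levelBoxes_of_fine {k : ℕ} (hk1 : 1 ≤ k) (hk : k ≤ (F.P K).m + (F.P K).K) (U' : GaugeField (F.P K) 0 (SU N))
    (hax : ∀ i < k, AxialGauge (radialContourData (F.P K) i (SU N)) (Averaging.iter (avOfRecord F N K) i U'))
    (a₀ : Fin (F.P K).d → ℤ) {M ρ : ℕ} (hM : 1 ≤ M) (hρ : 1 ≤ ρ) (hwrap : M + 4 * ρ < (F.P K).sitesPerDir k)
    {lo hi : ℕ → Fin (F.P K).d → ℤ}
    (hlo0 : lo 0 = fun i => ((F.P K).L : ℤ) * (sqLo (F.P K).L a₀ ρ k 1 i - 1))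
    (hhi0 : hi 0 = fun i => ((F.P K).L : ℤ) * (sqHi (F.P K).L a₀ M ρ k 1 i + 1) + (((F.P K).L : ℤ) - 1))
    (hloj : ∀ j, 1 ≤ j → lo j = sqLo (F.P K).L a₀ ρ k j - 1) (hhij : ∀ j, 1 ≤ j → hi j = sqHi (F.P K).L a₀ M ρ k j + 1)
    {α₀ : ℝ} (hα : 0 < α₀) (hα3 : (143 * (((((F.P K).d + 4 : ℕ) : ℝ)) ^ 2 / 4) ^ 2) * α₀ ≤ 1 / 3)
    (hα2 : 2 * α₀ ≤ 2 * deltaSU (Fin N) / ((((F.P K).d + 4) * (F.P K).L : ℕ) : ℝ) ^ 2)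
    (h52 : PlaqSmallOn {q : Plaq (F.P K) 0 | ∃ x : Fin (F.P K).d → ℤ,
        (∀ κ, tlo (F.P K).L (tLo a₀ ρ) k κ - ((((F.P K).L + (((F.P K).d + 4) * (F.P K).L + 2)) * gs (F.P K).L k : ℕ) : ℤ) ≤ x κ ∧
          x κ ≤ thi (F.P K).L (tHi a₀ M ρ) k κ + ((((F.P K).L + (((F.P K).d + 4) * (F.P K).L + 2)) * gs (F.P K).L k : ℕ) : ℤ)) ∧ q.src = castSite x}
      (α₀ * (F.P K).eta k ^ 2) U') :
    ∀ j ≤ k, ∀ c : PBond (F.P K) j, c.src ∈ (castSite '' Set.Icc (lo j) (hi j) : Set (Site (F.P K) j)) → c.tgt ∈ (castSite '' Set.Icc (lo j) (hi j) : Set (Site (F.P K) j)) →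
      dist1 (Averaging.iter (avOfRecord F N K) j (gaugeAct (blockLift k (axialGauge (Averaging.iter (avOfRecord F N K) k U') (tLo a₀ ρ) (tHi a₀ M ρ))) U') c) ≤
        (((F.P K).d - 1 : ℕ) : ℝ) * ((M + 4 * ρ - 1 : ℕ) : ℝ) * (2 * α₀) +
          (7 * ((((((F.P K).d + 2) * (F.P K).L : ℕ) : ℝ) ^ 2 / 4)) +
              ((((((F.P K).d + 1) * ((F.P K).L - 1) : ℕ) : ℝ)) + 1) *
                (((((F.P K).d * ((F.P K).L - 1) + 1 : ℕ) : ℝ)) * (((((F.P K).d - 1 : ℕ) : ℝ) * (((F.P K).L - 1 : ℕ) : ℝ))))) *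
            ∑ i ∈ Finset.Ico j k, 2 * α₀ * ((((F.P K).L : ℝ) ^ i * (F.P K).eta k) ^ 2) := by
  obtain ⟨hlev, htop⟩ := plaqSmallOn_tildeTowerWide_of_fine (F := F) (N := N) hk a₀ M ρ hα hα3 hα2 h52
  refine dist1_iter_le_down_the_radialRep_levelBoxes_explicit hk1 hk U' hax a₀ hM hρ hwrap hlo0 hhi0 hloj hhij
    (boxPlaqs_tilde_subset_tildeTowerWide (P := F.P K) a₀ M ρ _ k) htop (by positivity)
    (fun i => 2 * α₀ * ((((F.P K).L : ℝ) ^ i * (F.P K).eta k) ^ 2)) (fun j _ => by positivity)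
    (fun j hj => smallness_ht_of_alpha (F.P K) (deltaSU_pos) hα2 hj.le) ?_ ?_
  · -- `hplaq`: the three block positions around a bond of `□̃^{(j+1)}`
    intro j hj c hs htg q hq'
    rw [dist1_plaqHol_iter_gaugeAct (by omega)]
    obtain ⟨z', hz', hy⟩ := exists_label_near_of_block_position c hs htg (blockOf q.src)
      (by rcases hq' with h | h | h <;> simp [h])
    exact hlev j hj.le q (mem_tildeTowerWide_of_blockOf_mem (P := F.P K) a₀ M ρ _ hk hj q
      (fun κ => by simpa only [Set.mem_Icc] using hz' κ) hy)
  · -- `hplaqB`: plaquettes based in a block of `□̃^{(j+1)}`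
    intro j hj y hy q hq'
    rw [dist1_plaqHol_iter_gaugeAct (by omega)]
    obtain ⟨s, hsI, hys⟩ := hy
    rw [Set.mem_Icc] at hsI
    exact hlev j hj.le q (mem_tildeTowerWide_of_blockOf_mem (P := F.P K) a₀ M ρ _ hk hj q (z' := s)
      (fun κ => ⟨by linarith [hsI.1 κ], by linarith [hsI.2 κ]⟩) (by rw [hq', hys]))

end Fine

end Summit.QuantumFields.YangMills.BalabanUVNodes.N07TildeTowerLettersFromFine
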